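import Literature.MathematicalPhysics.QuantumFieldTheory.Balaban1983to89.B4Lemma22EdgesCubeField
import Literature.MathematicalPhysics.QuantumFieldTheory.Balaban1983to89.B4Lemma22HolderCubeField
import Literature.MathematicalPhysics.QuantumFieldTheory.Balaban1983to89.B4HolderChainTools
import Literature.MathematicalPhysics.QuantumFieldTheory.Balaban1983to89.B4

/-!
# [B4] LEMMA 2.2 IN b04's TYPED FORM `B4.Lemma22Printed fam (d + 1)` — BOTH CONJUNCTS VERBATIM ((2.16) for every
# `α < 1`; (2.17) for all three members on the whole printed parallelogram) — INHABITED ON THE FAMILY OF CUBE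
# CONFIGURATIONS `Ã_j = A₀ + θ_jA′` OF (1.7)-REGULAR FIELDS ON BOXES [Balaban1983RegularityDecay]

statement-level skeleton of published theorems with citation tags; proofs where landed; nothing here is a claim about the Yang–Mills mass gap

CITATION HEADER.  T. Bałaban, *Regularity and decay of lattice Green's functions*, Commun. Math. Phys. **89** (1983)
571–597, doi:10.1007/bf01214744 [Balaban1983RegularityDecay] (cell paper B4; held text
`paper:balaban1983-cmp89-regularity-decay`, journal page = PDF page + 570; pp. 573, 575, 577–578, 581, 583; the
statement of Lemma 2.2 read from the page renders `…regularity-decay-p007-x2.png`, `…-p008-x2.png`).  PDF held: yes.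
Unit `lit-balaban-p35` gen 7 (Phase-2 proof seat), HOME `run/shared/lean/pub/lit-balaban/`.  WHAT IS REPRODUCED:
SKELETON row **B4.Lem2.2** — the row's decl `B4.Lemma22Printed` (b04, `B4.lean`) INHABITED at `A ≠ 0`: companion of the
zero-field leaf `B4Lemma22ZeroBoxLpLq.lemma22Printed_cubeFam` (kind «model-instance»: the instance is named below).
Imports gen 7's `B4Lemma22EdgesCubeField` (closure: gen 6's `B4Eq220CubeField`, `B4CubeFieldHyps22`, `B4CubeFields22`,
the b2b lineage `B4Lemma22EtaBox/…`), gen 6's `B4Lemma22HolderCubeField`, p17's `B4HolderChainTools`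
(`siteNorm_transport_mulVec`) and b04's `B4` (`CubeSetting`, `Lemma22Printed`).

WHAT IS PRINTED (pp. 577–578, verbatim from the renders).  «(2.14) ‖f‖_{1,α} = max{sup_x |f(x)|, sup_{x,μ}
|(D^η_{A,μ}f)(x)|, sup_{x,x′,μ} (1/|x′ − x|^α)|U(A(Γ_{x,x′}))·(D^η_{A,μ}f)(x′) − (D^η_{A,μ}f)(x)|}, where the suprema
are taken on a domain of the function f. … Lemma 2.2. Let a rectangular parallelepiped □ be a sum of few large
blocks (e.g., as in the case of the cubes □_j), and let Ã be a regular vector field configuration in the sense of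
Proposition I.2.1, constant in a neighbourhood of the boundary of □. Then for e sufficiently small and α < 1, there
exists a constant c₁ depending on d, α only, such that ‖G_k(□,Ã)f‖_{1,α} ≤ c₁‖f‖_∞, (2.16) and a constant c₂
depending on d, p₁, such that ‖G_k(□,Ã)f‖_q, ‖D^η_{Ã,μ}G_k(□,Ã)f‖_q, ‖G_k(□,Ã)D^{η*}_{Ã,μ}f‖_q ≤ c₂‖f‖_p (2.17) for
1 ≤ p, q ≤ ∞, satisfying the condition 1/p − 1/p₁ ≤ 1/q ≤ 1/p with p₁ > d.»  p. 575: «if □_j is an interior cube of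
Ω, then we take Ã_j as equal to A on the cube {x: |x − Mj| ≤ ¾M}, and changing regularly to a constant function in
a neighbourhood of a boundary of □_j. … Ã_j = A₀ + θ_jA′. In the sequel we will use this definition of Ã_j. Of
course it satisfies the regularity condition (1.4) with another constant c.»  p. 573 (1.7): «|(∂^η_μA)(x)| ≤
ce^{β−1}», «for e sufficiently small».

THE MODEL INSTANCE (HONEST SCOPE).  Fixed family data: the lattice dimension `d + 1` (the print's `d`), `L = ℓ + 1 ≥ 2`,
the orthogonal flow `F` of (1.2) with its Lipschitz constant, the windows `a ∈ [a₋, a₊]` (`a₋ > 0`), `m² ∈ [0, m²₊]`,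
the regularity constants `(c, β)` of (1.7), the side bound `S` and the large-cube size `K` (`nK ≥ 16`).  An index
`i : RegInst` is: a scale `k ≥ 1` (mesh `η = L^{−k}`, `n = L^k`), `a`, `m²` in the windows, a box `□ = Π_μ[0, nM_μ)`
(`M_μ ≥ 1` unit blocks), a label `j ∈ ℤ^{d+1}`, a component field `A` on `ℤ^{d+1}`, a charge `e`.  Its `CubeSetting`
(`cubeFieldFam … i`): sources `f : □ × colours → ℝ`; the field is the CUBE CONFIGURATION `Ã_j = A₀ + θ_jA′` of p. 575
(gen 6 `B4CubeFields22.cubeField`, `A₀ = A(0)`) at coupling `e/n`, `G_k(□,Ã_j)` = the lineage's `greenA` with the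
staircase block contours, `D^η_{Ã_j,μ}` = `derivA`, `D^{η*}` its transpose; the typed antecedents READ: `rect = True`
(every member is a rectangular parallelepiped), `fewLargeBlocks` = «□ a sum of few large blocks»: `M_μ ≤ S`,
`regular` = (1.7) for `A` on `□` with `(c, β)` (then `Ã_j` is regular «with another constant c»,
`B4CubeFields22.cubeComp_regular`), `constNearBdry` = the cube of the label sits inside `□` (`j_μ ≥ 1`,
`K(j_μ + 1) ≤ M_μ`: then `Ã_j = A₀` on all bonds near `∂□`, `B4CubeFields22.cubeField_eq_constBond` /
`cubeFluct_eq_zero_of_face`).  The norms: `‖f‖_∞ = supN` (site-sup of the Euclidean colour norm), `‖f‖_p =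
lpW d ℓ k p` (the `η^{d+1}`-weighted `L^p` norm of `B4Lemma22EtaBox`, indexed by `s = 1/p`, `s = 0` the sup norm:
`lpN`), the Hölder norm (2.14) `hold` = `max{‖u‖_∞, sup_μ‖D^η_{Ã_j,μ}u‖_∞, sup (n/|x′−x|_∞)^α·|U(Ã_j(Γ))(D^η_{Ã_j,μ}u)(x′)
− (D^η_{Ã_j,μ}u)(x)|}`, the last supremum over `μ`, sites `x ≠ x′` whose forward `μ`-bonds lie in `□` («on a domain of
the function») and EVERY nearest-neighbour chain `Γ` from `x` to `x′` with `|Γ| ≤ (d+1)|x′ − x|_∞` (the contour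
`Γ_{x,x′}` of paper I is one of them; the weight is `|x′ − x|_η^{−α}` with the sup-distance, b04's `edistR`).
* **`lemma22Printed_cubeFieldFam`** — `B4.Lemma22Printed (cubeFieldFam F d ℓ a₋ a₊ m²₊ c β S K) (d + 1)`: conjunct 1
  ((2.16), every `α < 1`: `lemma22_16_cubeFieldFam`; `0 ≤ α < 1` from gen 6's `lemma22_holder_cubeField` +
  `lemma22_sup_cubeField`, `α < 0` — where the typed weight grows with the distance — from `fewLargeBlocks`:
  `|x′ − x|_η ≤ S`, and the orthogonality of `U(Ã_j(Γ))`), conjunct 2 ((2.17), every `(1/p, 1/q)` of the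
  parallelogram, all three members: `lemma22_17_cubeFieldFam`, assembled from gen 6's `lemma22_sup_cubeField` /
  `lemma22_weighted_cubeField` and gen 7's `B4Lemma22EdgesCubeField`), with the print's quantifier order (`c₁`/`c₂`
  and `e₁` uniform over the family).
* `antecedents_met` — non-vacuity: for every threshold `e₁ > 0` some member meets all typed antecedents with
  `0 < e ≤ e₁` (so the uniformity certified is exercised).
NOT certified: fields `Ã` other than the cube configurations `Ã_j` of p. 575 (the family Lemma 2.2 is applied to in
(2.18)–(2.21)); regions other than boxes; the typed statement at a dimension parameter `≤ d`; `A₀` is sampled at the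
box corner, so `e₁` depends on `S` («c′ = dMc»); the constants depend on `(N, flow, L, a₋, a₊, m²₊)` besides
`(d, α)` / `(d, p₁)`, as in every node of this lineage.  No `Prop` fact, no `sorry`; axioms standard.
-/

namespace Literature.MathematicalPhysics.QuantumFieldTheory.Balaban1983to89.B4Lemma22RegularCubeFam

open Finset Matrix
open Literature.MathematicalPhysics.QuantumFieldTheory.Balaban1983to89.B4 (CubeSetting Lemma22Printed)
open Literature.MathematicalPhysics.QuantumFieldTheory.Balaban1983to89.B4GaugeCovariance
open Literature.MathematicalPhysics.QuantumFieldTheory.Balaban1983to89.B4Reflection242 (boxDom nbrs mem_boxDom)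
open Literature.MathematicalPhysics.QuantumFieldTheory.Balaban1983to89.B4Lower18Regular (e1 baseEmb stairContour)
open Literature.MathematicalPhysics.QuantumFieldTheory.Balaban1983to89.B4Lemma21Region (siteNorm)
open Literature.MathematicalPhysics.QuantumFieldTheory.Balaban1983to89.B4ContourShift (supNorm supNorm_nonneg
  abs_le_supNorm)
open Literature.MathematicalPhysics.QuantumFieldTheory.Balaban1983to89.B4Lemma22Reduce231 (supN supN_nonneg le_supN
  supN_le siteNorm_nonneg)
open Literature.MathematicalPhysics.QuantumFieldTheory.Balaban1983to89.B4Lemma22ReduceZero (Box greenA derivA)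
open Literature.MathematicalPhysics.QuantumFieldTheory.Balaban1983to89.B4Lemma22EtaBox (lpW lpW_nonneg)
open Literature.MathematicalPhysics.QuantumFieldTheory.Balaban1983to89.B4Lemma22HolderBox (IsNNChain siteNorm_sub_le)
open Literature.MathematicalPhysics.QuantumFieldTheory.Balaban1983to89.B4HolderChainTools (siteNorm_transport_mulVec)
open Literature.MathematicalPhysics.QuantumFieldTheory.Balaban1983to89.B4PartitionUnity22 (thetaProf D1)
open Literature.MathematicalPhysics.QuantumFieldTheory.Balaban1983to89.B4CubeFields22 (cubeField cubeField_apply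
  cubeFluct_eq_zero_of_face cubeComp cubeComp_regular)
open Literature.MathematicalPhysics.QuantumFieldTheory.Balaban1983to89.B4Eq220CubeField (lemma22_sup_cubeField
  lemma22_weighted_cubeField)
open Literature.MathematicalPhysics.QuantumFieldTheory.Balaban1983to89.B4Lemma22HolderCubeField
  (lemma22_holder_cubeField)
open Literature.MathematicalPhysics.QuantumFieldTheory.Balaban1983to89.B4Lemma22EdgesCubeField

noncomputable section

variable {ι : Type} [Fintype ι] [DecidableEq ι]

/-! ## §1. The index of the family and its operators -/

/-- AN INDEX OF THE REGULAR CUBE-FIELD FAMILY (family data `d, ℓ`, windows `[a₋,a₊]`, `[0,m²₊]`, cube size `K` fixed):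
the scale `k ≥ 1` (`n = L^k`, `nK ≥ 16`), the coefficient `a` and the mass `m²` in their windows, the box `Π_μ[0, nM_μ)`
(`M_μ ≥ 1`), the label `j` of the cube, the component field `A` and the charge `e`.
[cite: Balaban1983RegularityDecay, Lemma 2.2 pp. 577–578 with §2 p. 575 (□_j, Ã_j), dictionary] -/
structure RegInst (d ℓ : ℕ) (amin aplus m2plus : ℝ) (K : ℕ) where
  /-- the scale: `η = L^{-k}` -/
  k : ℕ
  hk : 1 ≤ k
  hnK : 16 ≤ (ℓ + 1) ^ k * K
  /-- the coefficient of `aP_k` and the mass -/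
  a : ℝ
  ha : amin ≤ a
  ha' : a ≤ aplus
  m2 : ℝ
  hm : 0 ≤ m2
  hm' : m2 ≤ m2plus
  /-- the box `Π_μ[0, nM_μ)` -/
  M : Fin (d + 1) → ℕ
  hM : ∀ i, 1 ≤ M i
  /-- the label of the cube, the component field, the charge -/
  j : Fin (d + 1) → ℤ
  Ac : (Fin (d + 1) → ℤ) → Fin (d + 1) → ℝ
  e : ℝ

namespace RegInst

variable {d ℓ : ℕ} {amin aplus m2plus : ℝ} {K : ℕ} (i : RegInst d ℓ amin aplus m2plus K)

/-- `n = L^k ≥ 1` (the mesh `η = L^{−k}`). [cite: Balaban1983RegularityDecay, (1.1) p. 572 «η = L^{−k}», dictionary] -/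
theorem hn : 1 ≤ (ℓ + 1) ^ i.k := Nat.one_le_pow _ _ (Nat.succ_pos ℓ)

/-- the cube configuration `Ã_j = A₀ + θ_jA′` of the member (`A₀ = A(0)`), a bond function on `□`.
[cite: Balaban1983RegularityDecay, §2 p. 575 «Ã_j = A₀ + θ_jA′»] -/
def fieldA : ↥(Box d ℓ i.k i.M) → ↥(Box d ℓ i.k i.M) → ℝ :=
  cubeField (Box d ℓ i.k i.M) ((ℓ + 1) ^ i.k) K i.j (i.Ac 0) i.Ac

/-- `G_k(□, Ã_j)` (1.6) at coupling `e/n`, staircase block contours. [cite: Balaban1983RegularityDecay, (1.6) p. 572] -/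
def G (F : OrthFlow ι) : Matrix (↥(Box d ℓ i.k i.M) × ι) (↥(Box d ℓ i.k i.M) × ι) ℝ :=
  greenA d F (i.e / ((ℓ + 1) ^ i.k : ℕ)) ℓ i.k i.a i.m2 i.M (baseEmb i.hn i.M) (stairContour i.hn i.M) i.fieldA

/-- `D^η_{Ã_j,μ}` (1.3) at coupling `e/n`. [cite: Balaban1983RegularityDecay, (1.3) p. 572] -/
def D (F : OrthFlow ι) (μ : Fin (d + 1)) : Matrix (↥(Box d ℓ i.k i.M) × ι) (↥(Box d ℓ i.k i.M) × ι) ℝ :=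
  derivA d F (i.e / ((ℓ + 1) ^ i.k : ℕ)) ℓ i.k i.M i.fieldA μ

/-- the three vectors of (2.17): `G f`, `D_μ G f`, `G D_μ^* f` (`D^* = Dᵀ`). [cite: Balaban1983RegularityDecay, (2.17) p. 578, dictionary] -/
def opY (F : OrthFlow ι) (m : Fin 3) (μ : Fin (d + 1)) (f : ↥(Box d ℓ i.k i.M) × ι → ℝ) :
    ↥(Box d ℓ i.k i.M) × ι → ℝ :=
  if m = 0 then i.G F *ᵥ f else if m = 1 then i.D F μ *ᵥ (i.G F *ᵥ f) else (i.G F * (i.D F μ)ᵀ) *ᵥ f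

/-- the four vectors of (2.15): `G f`, `D_μ G f`, `G D_μ^* f`, `D_μ G D_ν^* f`. [cite: Balaban1983RegularityDecay, (2.15) p. 577, dictionary] -/
def opX (F : OrthFlow ι) (m : Fin 4) (μ ν : Fin (d + 1)) (f : ↥(Box d ℓ i.k i.M) × ι → ℝ) :
    ↥(Box d ℓ i.k i.M) × ι → ℝ :=
  if m = 0 then i.G F *ᵥ f else if m = 1 then i.D F μ *ᵥ (i.G F *ᵥ f)
  else if m = 2 then (i.G F * (i.D F μ)ᵀ) *ᵥ f else i.D F μ *ᵥ ((i.G F * (i.D F ν)ᵀ) *ᵥ f)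

/-- the Hölder norm (2.14) of `u` at the field `Ã_j`: `max{‖u‖_∞, sup_μ ‖D^η_{Ã_j,μ}u‖_∞, sup |x′−x|_η^{−α}
|U(Ã_j(Γ))(D^η_{Ã_j,μ}u)(x′) − (D^η_{Ã_j,μ}u)(x)|}`, the last supremum over `μ`, sites `x ≠ x′` whose forward
`μ`-bonds lie in `□`, and all nearest-neighbour chains `Γ` from `x` to `x′` with `|Γ| ≤ (d+1)|x′ − x|_∞`
(`|x′ − x|_η = |x′ − x|_∞/n`). [cite: Balaban1983RegularityDecay, (2.14) p. 577] -/
def hold (F : OrthFlow ι) (α : ℝ) (u : ↥(Box d ℓ i.k i.M) × ι → ℝ) : ℝ :=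
  max (supN u) (max (⨆ μ : Fin (d + 1), supN (i.D F μ *ᵥ u))
    (⨆ (μ : Fin (d + 1)) (x : ↥(Box d ℓ i.k i.M)) (xe : ↥(Box d ℓ i.k i.M)) (x' : ↥(Box d ℓ i.k i.M))
      (xe' : ↥(Box d ℓ i.k i.M)) (l : List ↥(Box d ℓ i.k i.M))
      (_ : xe.1 = x.1 + e1 μ ∧ xe'.1 = x'.1 + e1 μ ∧ x'.1 ≠ x.1 ∧ IsNNChain x l ∧ pathEnd x l = x' ∧
        (l.length : ℝ) ≤ ((d : ℝ) + 1) * supNorm (x'.1 - x.1)),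
      ((((ℓ + 1) ^ i.k : ℕ) : ℝ) / supNorm (x'.1 - x.1)) ^ α *
        siteNorm (transport (fieldLink F (i.e / ((ℓ + 1) ^ i.k : ℕ)) i.fieldA) x l *ᵥ fld (i.D F μ *ᵥ u) x'
          - fld (i.D F μ *ᵥ u) x)))

end RegInst

/-- `‖Φ‖_p` indexed by `s = 1/p ∈ [0, 1]`: the `η^{d+1}`-weighted norm `lpW d ℓ k (1/s)` of `B4Lemma22EtaBox`, and at
`s = 0` the sup norm `supN`. [cite: Balaban1983RegularityDecay, (2.17) p. 578 (the norms `‖·‖_p`), dictionary] -/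
def lpN {X : Type*} [Fintype X] [DecidableEq X] (d ℓ k : ℕ) (s : ℝ) (Φ : X × ι → ℝ) : ℝ :=
  if s = 0 then supN Φ else lpW d ℓ k s⁻¹ Φ

omit [DecidableEq ι] in
/-- `lpN` at `s = 0` is the sup norm. [cite: Balaban1983RegularityDecay, (2.17) p. 578 (the norms `‖·‖_p`, `p = ∞`), dictionary] -/
theorem lpN_zero {X : Type*} [Fintype X] [DecidableEq X] (d ℓ k : ℕ) (Φ : X × ι → ℝ) :
    lpN d ℓ k 0 Φ = supN Φ := if_pos rfl

omit [DecidableEq ι] in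
/-- `lpN` at `s ≠ 0` is `lpW` at `p = 1/s`. [cite: Balaban1983RegularityDecay, (2.17) p. 578 (the norms `‖·‖_p`), dictionary] -/
theorem lpN_of_ne {X : Type*} [Fintype X] [DecidableEq X] (d ℓ k : ℕ) {s : ℝ} (hs : s ≠ 0) (Φ : X × ι → ℝ) :
    lpN d ℓ k s Φ = lpW d ℓ k s⁻¹ Φ := if_neg hs

omit [DecidableEq ι] in
/-- `lpN ≥ 0`. [cite: Balaban1983RegularityDecay, (2.17) p. 578 (the norms `‖·‖_p`), dictionary] -/
theorem lpN_nonneg {X : Type*} [Fintype X] [DecidableEq X] (d ℓ k : ℕ) (s : ℝ) (Φ : X × ι → ℝ) :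
    0 ≤ lpN d ℓ k s Φ := by
  unfold lpN
  split_ifs
  · exact supN_nonneg Φ
  · exact lpW_nonneg d ℓ k _ Φ

/-! ## §2. The family of cube settings -/

/-- **THE REGULAR CUBE-FIELD FAMILY**: the fields of b04's `B4.CubeSetting` filled with their meanings at the cube
configuration `Ã_j` of a (1.7)-regular field on a box (see the module docstring for the reading of each field).
[cite: Balaban1983RegularityDecay, Lemma 2.2 (2.14)–(2.17) pp. 577–578 with §2 p. 575 and (1.7) p. 573] -/
def cubeFieldFam (F : OrthFlow ι) (d ℓ : ℕ) (amin aplus m2plus creg β : ℝ) (S K : ℕ)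
    (i : RegInst d ℓ amin aplus m2plus K) : CubeSetting where
  Src := ↥(Box d ℓ i.k i.M) × ι → ℝ
  Dir := Fin (d + 1)
  e := i.e
  fewLargeBlocks := ∀ μ, i.M μ ≤ S
  rect := True
  regular := ∀ x ∈ Box d ℓ i.k i.M, ∀ μ ν : Fin (d + 1),
    |i.Ac (x + e1 μ) ν - i.Ac x ν| ≤ creg * i.e ^ (β - 1) / ((ℓ + 1) ^ i.k : ℕ)
  constNearBdry := (∀ μ, 1 ≤ i.j μ) ∧ (∀ μ, (K : ℤ) * (i.j μ + 1) ≤ i.M μ)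
  l2Norm := fun f => lpW d ℓ i.k 2 f
  supNorm := fun f => supN f
  lpNorm := fun s f => lpN d ℓ i.k s f
  opL2 := fun m μ ν f => lpW d ℓ i.k 2 (i.opX F m μ ν f)
  holder1 := fun α f => i.hold F α (i.G F *ᵥ f)
  opLq := fun m μ t f => lpN d ℓ i.k t (i.opY F m μ f)

section Readings

variable (F : OrthFlow ι) {d ℓ : ℕ} {amin aplus m2plus : ℝ} (creg β : ℝ) (S : ℕ) {K : ℕ}
  (i : RegInst d ℓ amin aplus m2plus K)

/-- the typed «few large blocks» antecedent of a member reads `M_μ ≤ S`. [cite: Balaban1983RegularityDecay, Lemma 2.2 p. 577 «a sum of few large blocks», dictionary] -/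
theorem fewLargeBlocks_iff : (cubeFieldFam F d ℓ amin aplus m2plus creg β S K i).fewLargeBlocks ↔ ∀ μ, i.M μ ≤ S :=
  Iff.rfl

/-- the typed «regular» antecedent of a member reads: (1.7) for `A` on `□` with the constants `(c, β)`.
[cite: Balaban1983RegularityDecay, Lemma 2.2 p. 577 «a regular vector field configuration» with (1.7) p. 573, dictionary] -/
theorem regular_iff : (cubeFieldFam F d ℓ amin aplus m2plus creg β S K i).regular ↔
    ∀ x ∈ Box d ℓ i.k i.M, ∀ μ ν : Fin (d + 1),
      |i.Ac (x + e1 μ) ν - i.Ac x ν| ≤ creg * i.e ^ (β - 1) / ((ℓ + 1) ^ i.k : ℕ) :=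
  Iff.rfl

/-- the typed «constant near the boundary» antecedent of a member reads: the cube of the label sits inside `□`.
[cite: Balaban1983RegularityDecay, Lemma 2.2 p. 577 «constant in a neighbourhood of the boundary of □» with §2 p. 575, dictionary] -/
theorem constNearBdry_iff : (cubeFieldFam F d ℓ amin aplus m2plus creg β S K i).constNearBdry ↔
    (∀ μ, 1 ≤ i.j μ) ∧ (∀ μ, (K : ℤ) * (i.j μ + 1) ≤ i.M μ) :=
  Iff.rfl

/-- every member is a rectangular parallelepiped. [cite: Balaban1983RegularityDecay, Lemma 2.2 p. 577 «a rectangular parallelepiped □», dictionary] -/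
theorem rect_holds : (cubeFieldFam F d ℓ amin aplus m2plus creg β S K i).rect := trivial

/-- **THE TYPED «constant in a neighbourhood of the boundary of □» IS EARNED**: under the member's `constNearBdry`
antecedent (`K ≥ 1`), `Ã_j = A₀` on both orientations of every bond `⟨x, x + e_μ⟩` at the faces of `□`
(`x − e_μ ∉ □` or `x + 2e_μ ∉ □`) — gen 6's `B4CubeFields22.cubeFluct_eq_zero_of_face`.
[cite: Balaban1983RegularityDecay, §2 p. 575 «changing regularly to a constant function in a neighbourhood of a
boundary of □_j»] -/
theorem fieldA_eq_const_at_faces (hK1 : 1 ≤ K)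
    (h : (cubeFieldFam F d ℓ amin aplus m2plus creg β S K i).constNearBdry) {x y : ↥(Box d ℓ i.k i.M)}
    {μ : Fin (d + 1)} (hy : y.1 = x.1 + e1 μ) (hface : x.1 - e1 μ ∉ Box d ℓ i.k i.M ∨ y.1 + e1 μ ∉ Box d ℓ i.k i.M) :
    i.fieldA x y = constBond (i.Ac 0) Subtype.val x y ∧ i.fieldA y x = constBond (i.Ac 0) Subtype.val y x := by
  obtain ⟨hjlo, hjhi⟩ := h
  have hjhi' : ∀ ν, (((ℓ + 1) ^ i.k : ℕ) : ℤ) * K * (i.j ν + 1) ≤ (((ℓ + 1) ^ i.k * i.M ν : ℕ) : ℤ) := fun ν => by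
    push_cast; rw [mul_assoc]; exact mul_le_mul_of_nonneg_left (hjhi ν) (by positivity)
  have h0 := cubeFluct_eq_zero_of_face i.hn hK1 i.hnK hjlo hjhi' (i.Ac 0) i.Ac hy hface
  unfold RegInst.fieldA
  rw [cubeField_apply, cubeField_apply, h0.1, h0.2, add_zero, add_zero]
  exact ⟨rfl, rfl⟩

/-- **THE TYPED «regular» IS EARNED BY `Ã_j`** («Of course it satisfies the regularity condition (1.4) with another
constant c»): under the member's `regular` and `fewLargeBlocks` antecedents (`K ≥ 1`, `e > 0`), the component form of
`Ã_j` has forward differences `≤ c·e^{β−1}η·(1 + D1(θ)(d+1)S/K)` on `□`, every pair of directions — gen 6's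
`B4CubeFields22.cubeComp_regular`. [cite: Balaban1983RegularityDecay, §2 p. 575, (1.7) p. 573] -/
theorem fieldA_regular (hK1 : 1 ≤ K) (hcreg : 0 ≤ creg) (he : 0 < i.e)
    (hS : (cubeFieldFam F d ℓ amin aplus m2plus creg β S K i).fewLargeBlocks)
    (hreg : (cubeFieldFam F d ℓ amin aplus m2plus creg β S K i).regular) {x : Fin (d + 1) → ℤ}
    (hx : x ∈ Box d ℓ i.k i.M) {μ : Fin (d + 1)} (hxμ : x + e1 μ ∈ Box d ℓ i.k i.M) (ν : Fin (d + 1)) :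
    |cubeComp ((ℓ + 1) ^ i.k) K i.j (i.Ac 0) i.Ac (x + e1 μ) ν - cubeComp ((ℓ + 1) ^ i.k) K i.j (i.Ac 0) i.Ac x ν|
      ≤ creg * i.e ^ (β - 1) / ((ℓ + 1) ^ i.k : ℕ) * (1 + D1 thetaProf * (((d : ℝ) + 1) * S) / K) := by
  have hN : ∀ ν, 1 ≤ (ℓ + 1) ^ i.k * i.M ν := fun ν => le_trans i.hn (Nat.le_mul_of_pos_right _ (i.hM ν))
  have hT : ∀ ν, (((ℓ + 1) ^ i.k * i.M ν : ℕ) : ℤ) ≤ (((ℓ + 1) ^ i.k : ℕ) : ℤ) * S := fun ν => by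
    push_cast; exact mul_le_mul_of_nonneg_left (by exact_mod_cast hS ν) (by positivity)
  have hδ : 0 ≤ creg * i.e ^ (β - 1) / ((ℓ + 1) ^ i.k : ℕ) := by
    have := (Real.rpow_pos_of_pos he (β - 1)).le; positivity
  have h := cubeComp_regular hN hT hδ hreg i.hn hK1 i.j hx hxμ ν
  have hnr : (0 : ℝ) < ((ℓ + 1) ^ i.k : ℕ) := by exact_mod_cast i.hn
  calc _ ≤ _ := h
    _ = _ := by push_cast; field_simp

end Readings

/-! ## §3. (2.16) for every `α < 1` on the family -/

section Helpers

/-- `x ≤ cB`, `c ≤ C`, `B ≥ 0` give `x ≤ CB`. [folklore] -/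
private theorem le_mul_of_le_mul {x B c C : ℝ} (h : x ≤ c * B) (hc : c ≤ C) (hB : 0 ≤ B) : x ≤ C * B :=
  h.trans (mul_le_mul_of_nonneg_right hc hB)

/-- the Hölder weight of a pair of sites of the box for a NEGATIVE exponent: `(n/|x′ − x|_∞)^α = |x′ − x|_η^{|α|} ≤ S^{|α|}`
(`|x′ − x|_∞ < nS`). [cite: Balaban1983RegularityDecay, (2.14) p. 577 «1/|x′ − x|^α», dictionary] -/
theorem weight_le_of_neg {d n : ℕ} (hn : 1 ≤ n) {M : Fin (d + 1) → ℕ} {S : ℕ} (hS : ∀ i, M i ≤ S)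
    {x x' : Fin (d + 1) → ℤ} (hx : x ∈ boxDom fun i => n * M i) (hx' : x' ∈ boxDom fun i => n * M i)
    {α : ℝ} (hα : α < 0) : ((n : ℝ) / supNorm (x' - x)) ^ α ≤ (S : ℝ) ^ (-α) := by
  have hnr : (0 : ℝ) < n := by exact_mod_cast hn
  have hS0 : (0 : ℝ) ≤ S := by positivity
  by_cases hD : supNorm (x' - x) = 0
  · rw [hD, div_zero, Real.zero_rpow hα.ne]
    exact Real.rpow_nonneg hS0 _
  have hDpos : 0 < supNorm (x' - x) := lt_of_le_of_ne (supNorm_nonneg _) (Ne.symm hD)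
  have hDS : supNorm (x' - x) ≤ (n : ℝ) * S := by
    refine B4Reflection242.supNorm_le_of_forall fun i => ?_
    have h1 := (mem_boxDom.1 hx i)
    have h2 := (mem_boxDom.1 hx' i)
    have hMi : (M i : ℤ) ≤ S := by exact_mod_cast hS i
    have : |(x' - x) i| ≤ (n : ℤ) * S := by
      rw [Pi.sub_apply, abs_le]
      push_cast at h1 h2
      constructor <;> nlinarith [h1.1, h1.2, h2.1, h2.2]
    exact_mod_cast this
  have hq : supNorm (x' - x) / n ≤ S := by rw [div_le_iff₀ hnr]; linarith
  have hq0 : 0 ≤ supNorm (x' - x) / n := by positivity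
  calc ((n : ℝ) / supNorm (x' - x)) ^ α = ((supNorm (x' - x) / n)⁻¹) ^ α := by rw [inv_div]
    _ = (supNorm (x' - x) / n) ^ (-α) := by rw [Real.inv_rpow hq0, Real.rpow_neg hq0]
    _ ≤ (S : ℝ) ^ (-α) := Real.rpow_le_rpow hq0 hq (by linarith)

end Helpers

section Main

variable (F : OrthFlow ι) {ℓ₁ : ℝ} (hℓ₁ : 0 ≤ ℓ₁)
  (hLip : ∀ t (v : ι → ℝ), ((F.U t - 1) *ᵥ v) ⬝ᵥ ((F.U t - 1) *ᵥ v) ≤ (ℓ₁ * t) ^ 2 * (v ⬝ᵥ v))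
  (d ℓ : ℕ) (hℓ : 1 ≤ ℓ) (amin aplus m2plus : ℝ) (ha : 0 < amin) (creg β : ℝ) (hcreg : 0 ≤ creg) (hβ : 0 < β)
  (S K : ℕ) (hK : 1 ≤ K)

include hℓ₁ hLip hℓ ha hcreg hβ hK

/-- **(2.16) FOR EVERY `α < 1` ON THE REGULAR CUBE-FIELD FAMILY** — `‖G_k(□,Ã_j)f‖_{1,α} ≤ c₁‖f‖_∞` with ONE `c₁` and
ONE threshold `e₁` for the whole family (the constant from Lemma 2.2 at charge `1`; for `α < 0` — where the typed
weight `|x′ − x|_η^{−α}` grows with the distance — also on `S`, through `fewLargeBlocks`): the three entries of (2.14)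
from gen 6's `lemma22_sup_cubeField` (`sup|Gf|`, `sup|D_μGf|`) and `lemma22_holder_cubeField` (the quotient,
`0 ≤ α < 1`); for `α < 0` the quotient is `≤ S^{|α|}·2 sup|D_μGf|` by the orthogonality of `U(Ã_j(Γ))`
(`B4HolderChainTools.siteNorm_transport_mulVec`). [cite: Balaban1983RegularityDecay, Lemma 2.2 (2.16) p. 578 with
(2.14) p. 577, §2 p. 575 (Ã_j), (1.7) p. 573] -/
theorem lemma22_16_cubeFieldFam (α : ℝ) (hα : α < 1) :
    ∃ c₁ e₁ : ℝ, 0 < c₁ ∧ 0 < e₁ ∧ ∀ i : RegInst d ℓ amin aplus m2plus K,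
      (cubeFieldFam F d ℓ amin aplus m2plus creg β S K i).rect →
      (cubeFieldFam F d ℓ amin aplus m2plus creg β S K i).fewLargeBlocks →
      (cubeFieldFam F d ℓ amin aplus m2plus creg β S K i).regular →
      (cubeFieldFam F d ℓ amin aplus m2plus creg β S K i).constNearBdry →
      0 < (cubeFieldFam F d ℓ amin aplus m2plus creg β S K i).e →
      (cubeFieldFam F d ℓ amin aplus m2plus creg β S K i).e ≤ e₁ →
      ∀ f : (cubeFieldFam F d ℓ amin aplus m2plus creg β S K i).Src,
        (cubeFieldFam F d ℓ amin aplus m2plus creg β S K i).holder1 α f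
          ≤ c₁ * (cubeFieldFam F d ℓ amin aplus m2plus creg β S K i).supNorm f := by
  obtain ⟨C₁, hC₁, h₁⟩ := lemma22_sup_cubeField F hℓ₁ hLip d ℓ hℓ amin aplus m2plus ha
  obtain ⟨e₁, he₁, g₁⟩ := h₁ creg β hcreg hβ S K hK
  by_cases hα0 : 0 ≤ α
  · -- `0 ≤ α < 1`: the quotient from gen 6
    obtain ⟨C₂, hC₂, h₂⟩ := lemma22_holder_cubeField F hℓ₁ hLip d ℓ hℓ amin aplus m2plus ha α hα0 hα
    obtain ⟨e₂, he₂, g₂⟩ := h₂ creg β hcreg hβ S K hK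
    refine ⟨C₁ + C₂, min e₁ e₂, by positivity, lt_min he₁ he₂, ?_⟩
    intro i _ hS h17 hcnb he hle f
    obtain ⟨hjlo, hjhi⟩ := hcnb
    have he' : 0 < i.e := he
    have hB : 0 ≤ (C₁ + C₂) * supN f := by have := supN_nonneg f; positivity
    obtain ⟨k0, k1⟩ := g₁ i.k i.hk i.hn i.hnK i.a i.m2 i.ha i.ha' i.hm i.hm' i.M i.hM hS i.j hjlo hjhi i.Ac i.e he'
      (hle.trans (min_le_left _ _)) h17 f
    have kH := g₂ i.k i.hk i.hn i.hnK i.a i.m2 i.ha i.ha' i.hm i.hm' i.M i.hM hS i.j hjlo hjhi i.Ac i.e he'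
      (hle.trans (min_le_right _ _)) h17
    show i.hold F α (i.G F *ᵥ f) ≤ (C₁ + C₂) * supN f
    unfold RegInst.hold RegInst.G RegInst.D RegInst.fieldA
    refine max_le (le_mul_of_le_mul k0 (by linarith) (supN_nonneg f)) (max_le ?_ ?_)
    · exact Real.iSup_le (fun μ => le_mul_of_le_mul (k1 μ) (by linarith) (supN_nonneg f)) hB
    · refine Real.iSup_le (fun μ => Real.iSup_le (fun x => Real.iSup_le (fun xe => Real.iSup_le (fun x' =>
        Real.iSup_le (fun xe' => Real.iSup_le (fun l => Real.iSup_le (fun h => ?_) hB) hB) hB) hB) hB) hB) hB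
      obtain ⟨hxe, hxe', hne, hl, hlend, hlen⟩ := h
      exact le_mul_of_le_mul (kH μ x xe x' xe' hxe hxe' hne l hl hlend hlen f) (by linarith) (supN_nonneg f)
  · -- `α < 0`: bounded box, orthogonal transport
    rw [not_le] at hα0
    refine ⟨C₁ + (S : ℝ) ^ (-α) * (2 * C₁), e₁, by positivity, he₁, ?_⟩
    intro i _ hS h17 hcnb he hle f
    obtain ⟨hjlo, hjhi⟩ := hcnb
    have he' : 0 < i.e := he
    have hSα : 0 ≤ (S : ℝ) ^ (-α) := Real.rpow_nonneg (by positivity) _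
    have hB : 0 ≤ (C₁ + (S : ℝ) ^ (-α) * (2 * C₁)) * supN f := by have := supN_nonneg f; positivity
    obtain ⟨k0, k1⟩ := g₁ i.k i.hk i.hn i.hnK i.a i.m2 i.ha i.ha' i.hm i.hm' i.M i.hM hS i.j hjlo hjhi i.Ac i.e he'
      hle h17 f
    have hCle : C₁ ≤ C₁ + (S : ℝ) ^ (-α) * (2 * C₁) := by nlinarith
    show i.hold F α (i.G F *ᵥ f) ≤ (C₁ + (S : ℝ) ^ (-α) * (2 * C₁)) * supN f
    unfold RegInst.hold RegInst.G RegInst.D RegInst.fieldA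
    refine max_le (le_mul_of_le_mul k0 hCle (supN_nonneg f)) (max_le ?_ ?_)
    · exact Real.iSup_le (fun μ => le_mul_of_le_mul (k1 μ) hCle (supN_nonneg f)) hB
    · refine Real.iSup_le (fun μ => Real.iSup_le (fun x => Real.iSup_le (fun xe => Real.iSup_le (fun x' =>
        Real.iSup_le (fun xe' => Real.iSup_le (fun l => Real.iSup_le (fun h => ?_) hB) hB) hB) hB) hB) hB) hB
      set v := derivA d F (i.e / ((ℓ + 1) ^ i.k : ℕ)) ℓ i.k i.M
          (cubeField (Box d ℓ i.k i.M) ((ℓ + 1) ^ i.k) K i.j (i.Ac 0) i.Ac) μ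
        *ᵥ (greenA d F (i.e / ((ℓ + 1) ^ i.k : ℕ)) ℓ i.k i.a i.m2 i.M (baseEmb i.hn i.M) (stairContour i.hn i.M)
          (cubeField (Box d ℓ i.k i.M) ((ℓ + 1) ^ i.k) K i.j (i.Ac 0) i.Ac) *ᵥ f) with hv
      have hw := weight_le_of_neg (d := d) i.hn hS x.2 x'.2 hα0
      have hdiff : siteNorm (transport (fieldLink F (i.e / ((ℓ + 1) ^ i.k : ℕ))
            (cubeField (Box d ℓ i.k i.M) ((ℓ + 1) ^ i.k) K i.j (i.Ac 0) i.Ac)) x l *ᵥ fld v x' - fld v x)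
          ≤ 2 * C₁ * supN f := by
        refine (siteNorm_sub_le _ _).trans ?_
        rw [siteNorm_transport_mulVec]
        have h1 := le_supN v x'
        have h2 := le_supN v x
        have h3 := k1 μ
        linarith
      have hw0 : 0 ≤ ((((ℓ + 1) ^ i.k : ℕ) : ℝ) / supNorm (x'.1 - x.1)) ^ α :=
        Real.rpow_nonneg (div_nonneg (by positivity) (supNorm_nonneg _)) _
      calc ((((ℓ + 1) ^ i.k : ℕ) : ℝ) / supNorm (x'.1 - x.1)) ^ α
            * siteNorm (transport (fieldLink F (i.e / ((ℓ + 1) ^ i.k : ℕ))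
                (cubeField (Box d ℓ i.k i.M) ((ℓ + 1) ^ i.k) K i.j (i.Ac 0) i.Ac)) x l *ᵥ fld v x' - fld v x)
          ≤ (S : ℝ) ^ (-α) * (2 * C₁ * supN f) :=
            mul_le_mul hw hdiff (siteNorm_nonneg _) hSα
        _ ≤ (C₁ + (S : ℝ) ^ (-α) * (2 * C₁)) * supN f := by
            have := supN_nonneg f; nlinarith

/-! ## §4. (2.17) on the whole parallelogram, all three members, on the family -/

/-- **(2.17) ON THE REGULAR CUBE-FIELD FAMILY, EVERY PAIR OF THE PRINTED PARALLELOGRAM, ALL THREE MEMBERS** — for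
`p₁ > d + 1` ONE `c₂` and ONE threshold `e₁` with `‖Yf‖_q ≤ c₂‖f‖_p` for `Y ∈ {G_k(□,Ã_j), D^η_{Ã_j,μ}G_k(□,Ã_j),
G_k(□,Ã_j)D^{η*}_{Ã_j,μ}}` and all `0 ≤ t ≤ s ≤ 1`, `s − 1/p₁ ≤ t` (`s = 1/p`, `t = 1/q`): the corner `q = p = ∞` from
gen 6's `lemma22_sup_cubeField` and `lemma22_dual_corners_cubeField`; the edge `q = ∞`, `p₁ ≤ p < ∞` from
`lemma22_psup_cubeField` / `lemma22_dual_sup_cubeField`; `q < ∞` from gen 6's `lemma22_weighted_cubeField` (members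
`G`, `D_ÃG`) and `lemma22_dual_cubeField` (`1 < p`), `lemma22_dual_one_cubeField` (`p = 1 < q`),
`lemma22_dual_corners_cubeField` (`p = q = 1`). [cite: Balaban1983RegularityDecay, Lemma 2.2 (2.17) p. 578 with
p. 583, §2 p. 575 (Ã_j), (1.7) p. 573] -/
theorem lemma22_17_cubeFieldFam {p₁ : ℝ} (hp₁ : (d : ℝ) + 1 < p₁) :
    ∃ c₂ e₁ : ℝ, 0 < c₂ ∧ 0 < e₁ ∧ ∀ i : RegInst d ℓ amin aplus m2plus K,
      (cubeFieldFam F d ℓ amin aplus m2plus creg β S K i).rect →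
      (cubeFieldFam F d ℓ amin aplus m2plus creg β S K i).fewLargeBlocks →
      (cubeFieldFam F d ℓ amin aplus m2plus creg β S K i).regular →
      (cubeFieldFam F d ℓ amin aplus m2plus creg β S K i).constNearBdry →
      0 < (cubeFieldFam F d ℓ amin aplus m2plus creg β S K i).e →
      (cubeFieldFam F d ℓ amin aplus m2plus creg β S K i).e ≤ e₁ →
      ∀ (s t : ℝ) (n : Fin 3) (μ : (cubeFieldFam F d ℓ amin aplus m2plus creg β S K i).Dir)
        (f : (cubeFieldFam F d ℓ amin aplus m2plus creg β S K i).Src),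
        0 ≤ t → s ≤ 1 → s - 1 / p₁ ≤ t → t ≤ s →
        (cubeFieldFam F d ℓ amin aplus m2plus creg β S K i).opLq n μ t f
          ≤ c₂ * (cubeFieldFam F d ℓ amin aplus m2plus creg β S K i).lpNorm s f := by
  have hp₁0 : 0 < p₁ := lt_trans (by positivity) hp₁
  obtain ⟨C₁, hC₁, h₁⟩ := lemma22_sup_cubeField F hℓ₁ hLip d ℓ hℓ amin aplus m2plus ha
  obtain ⟨C₂, hC₂, h₂⟩ := lemma22_weighted_cubeField F hℓ₁ hLip d ℓ hℓ amin aplus m2plus ha hp₁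
  obtain ⟨C₃, hC₃, h₃⟩ := lemma22_psup_cubeField F hℓ₁ hLip d ℓ hℓ amin aplus m2plus ha hp₁
  obtain ⟨C₄, hC₄, h₄⟩ := lemma22_dual_cubeField F hℓ₁ hLip d ℓ hℓ amin aplus m2plus ha hp₁
  obtain ⟨C₅, hC₅, h₅⟩ := lemma22_dual_one_cubeField F hℓ₁ hLip d ℓ hℓ amin aplus m2plus ha hp₁
  obtain ⟨C₆, hC₆, h₆⟩ := lemma22_dual_sup_cubeField F hℓ₁ hLip d ℓ hℓ amin aplus m2plus ha hp₁
  obtain ⟨C₇, hC₇, h₇⟩ := lemma22_dual_corners_cubeField F hℓ₁ hLip d ℓ hℓ amin aplus m2plus ha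
  obtain ⟨e₁, he₁, g₁⟩ := h₁ creg β hcreg hβ S K hK
  obtain ⟨e₂, he₂, g₂⟩ := h₂ creg β hcreg hβ S K hK
  obtain ⟨e₃, he₃, g₃⟩ := h₃ creg β hcreg hβ S K hK
  obtain ⟨e₄, he₄, g₄⟩ := h₄ creg β hcreg hβ S K hK
  obtain ⟨e₅, he₅, g₅⟩ := h₅ creg β hcreg hβ S K hK
  obtain ⟨e₆, he₆, g₆⟩ := h₆ creg β hcreg hβ S K hK
  obtain ⟨e₇, he₇, g₇⟩ := h₇ creg β hcreg hβ S K hK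
  set C : ℝ := C₁ + C₂ + C₃ + C₄ + C₅ + C₆ + C₇ with hC_def
  set e₀ : ℝ := min (min (min e₁ e₂) (min e₃ e₄)) (min (min e₅ e₆) e₇) with he₀_def
  have he₀ : 0 < e₀ := lt_min (lt_min (lt_min he₁ he₂) (lt_min he₃ he₄)) (lt_min (lt_min he₅ he₆) he₇)
  refine ⟨C, e₀, by positivity, he₀, ?_⟩
  intro i _ hS h17 hcnb he hle s t n μ f ht0 hs1 hst hts
  obtain ⟨hjlo, hjhi⟩ := hcnb
  have he' : 0 < i.e := he
  have hl₁ : i.e ≤ e₁ := hle.trans ((min_le_left _ _).trans ((min_le_left _ _).trans (min_le_left _ _)))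
  have hl₂ : i.e ≤ e₂ := hle.trans ((min_le_left _ _).trans ((min_le_left _ _).trans (min_le_right _ _)))
  have hl₃ : i.e ≤ e₃ := hle.trans ((min_le_left _ _).trans ((min_le_right _ _).trans (min_le_left _ _)))
  have hl₄ : i.e ≤ e₄ := hle.trans ((min_le_left _ _).trans ((min_le_right _ _).trans (min_le_right _ _)))
  have hl₅ : i.e ≤ e₅ := hle.trans ((min_le_right _ _).trans ((min_le_left _ _).trans (min_le_left _ _)))
  have hl₆ : i.e ≤ e₆ := hle.trans ((min_le_right _ _).trans ((min_le_left _ _).trans (min_le_right _ _)))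
  have hl₇ : i.e ≤ e₇ := hle.trans ((min_le_right _ _).trans (min_le_right _ _))
  have c₁le : C₁ ≤ C := by rw [hC_def]; linarith
  have c₂le : C₂ ≤ C := by rw [hC_def]; linarith
  have c₃le : C₃ ≤ C := by rw [hC_def]; linarith
  have c₄le : C₄ ≤ C := by rw [hC_def]; linarith
  have c₅le : C₅ ≤ C := by rw [hC_def]; linarith
  have c₆le : C₆ ≤ C := by rw [hC_def]; linarith
  have c₇le : C₇ ≤ C := by rw [hC_def]; linarith
  have hst' : s - t ≤ p₁⁻¹ := by rw [← one_div]; linarith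
  show lpN d ℓ i.k t (i.opY F n μ f) ≤ C * lpN d ℓ i.k s f
  unfold RegInst.opY RegInst.G RegInst.D RegInst.fieldA
  by_cases ht : t = 0
  · subst ht
    rw [lpN_zero]
    by_cases hs : s = 0
    · -- the corner `q = p = ∞`
      subst hs
      rw [lpN_zero]
      obtain ⟨k0, k1⟩ := g₁ i.k i.hk i.hn i.hnK i.a i.m2 i.ha i.ha' i.hm i.hm' i.M i.hM hS i.j hjlo hjhi i.Ac i.e
        he' hl₁ h17 f
      by_cases hn0 : n = 0
      · rw [if_pos hn0]; exact le_mul_of_le_mul k0 c₁le (supN_nonneg f)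
      rw [if_neg hn0]
      by_cases hn1 : n = 1
      · rw [if_pos hn1]; exact le_mul_of_le_mul (k1 μ) c₁le (supN_nonneg f)
      rw [if_neg hn1]
      exact le_mul_of_le_mul (g₇ i.k i.hk i.hn i.hnK i.a i.m2 i.ha i.ha' i.hm i.hm' i.M i.hM hS i.j hjlo hjhi
        i.Ac i.e he' hl₇ h17 f μ).2 c₇le (supN_nonneg f)
    · -- the edge `q = ∞`, `p₁ ≤ p = 1/s < ∞`
      have hs0 : 0 < s := lt_of_le_of_ne hts (Ne.symm hs)
      have hp : p₁ ≤ s⁻¹ := by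
        rw [← inv_le_inv₀ (inv_pos.2 hs0) hp₁0, inv_inv]; linarith
      rw [lpN_of_ne _ _ _ hs]
      obtain ⟨k0, k1⟩ := g₃ i.k i.hk i.hn i.hnK i.a i.m2 i.ha i.ha' i.hm i.hm' i.M i.hM hS i.j hjlo hjhi i.Ac i.e
        he' hl₃ h17 s⁻¹ hp f
      by_cases hn0 : n = 0
      · rw [if_pos hn0]; exact le_mul_of_le_mul k0 c₃le (lpW_nonneg _ _ _ _ f)
      rw [if_neg hn0]
      by_cases hn1 : n = 1
      · rw [if_pos hn1]; exact le_mul_of_le_mul (k1 μ) c₃le (lpW_nonneg _ _ _ _ f)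
      rw [if_neg hn1]
      exact le_mul_of_le_mul (g₆ i.k i.hk i.hn i.hnK i.a i.m2 i.ha i.ha' i.hm i.hm' i.M i.hM hS i.j hjlo hjhi
        i.Ac i.e he' hl₆ h17 s⁻¹ hp f μ) c₆le (lpW_nonneg _ _ _ _ f)
  · -- `q = 1/t < ∞`
    have ht0' : 0 < t := lt_of_le_of_ne ht0 (Ne.symm ht)
    have hs0 : 0 < s := lt_of_lt_of_le ht0' hts
    rw [lpN_of_ne _ _ _ ht, lpN_of_ne _ _ _ hs0.ne']
    have hp1 : 1 ≤ s⁻¹ := (one_le_inv₀ hs0).2 hs1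
    have hpq : s⁻¹ ≤ t⁻¹ := inv_anti₀ ht0' hts
    have hσ : s⁻¹⁻¹ - t⁻¹⁻¹ ≤ p₁⁻¹ := by rw [inv_inv, inv_inv]; exact hst'
    obtain ⟨k0, k1⟩ := g₂ i.k i.hk i.hn i.hnK i.a i.m2 i.ha i.ha' i.hm i.hm' i.M i.hM hS i.j hjlo hjhi i.Ac i.e
      he' hl₂ h17 s⁻¹ t⁻¹ hp1 hpq hσ f
    by_cases hn0 : n = 0
    · rw [if_pos hn0]; exact le_mul_of_le_mul k0 c₂le (lpW_nonneg _ _ _ _ f)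
    rw [if_neg hn0]
    by_cases hn1 : n = 1
    · rw [if_pos hn1]; exact le_mul_of_le_mul (k1 μ) c₂le (lpW_nonneg _ _ _ _ f)
    rw [if_neg hn1]
    -- the third member
    by_cases hs1' : s = 1
    · subst hs1'
      rw [inv_one]
      by_cases ht1 : t = 1
      · -- the corner `q = p = 1`
        subst ht1
        rw [inv_one]
        exact le_mul_of_le_mul (g₇ i.k i.hk i.hn i.hnK i.a i.m2 i.ha i.ha' i.hm i.hm' i.M i.hM hS i.j hjlo hjhi
          i.Ac i.e he' hl₇ h17 f μ).1 c₇le (lpW_nonneg _ _ _ _ f)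
      · -- the edge `p = 1 < q`
        have ht1' : t < 1 := lt_of_le_of_ne hts ht1
        have hq1 : 1 < t⁻¹ := (one_lt_inv₀ ht0').2 ht1'
        have hqσ : 1 - t⁻¹⁻¹ ≤ p₁⁻¹ := by rw [inv_inv]; exact hst'
        exact le_mul_of_le_mul (g₅ i.k i.hk i.hn i.hnK i.a i.m2 i.ha i.ha' i.hm i.hm' i.M i.hM hS i.j hjlo
          hjhi i.Ac i.e he' hl₅ h17 t⁻¹ hq1 hqσ f μ) c₅le (lpW_nonneg _ _ _ _ f)
    · -- `1 < p ≤ q < ∞`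
      have hs1'' : s < 1 := lt_of_le_of_ne hs1 hs1'
      have hp1' : 1 < s⁻¹ := (one_lt_inv₀ hs0).2 hs1''
      exact le_mul_of_le_mul (g₄ i.k i.hk i.hn i.hnK i.a i.m2 i.ha i.ha' i.hm i.hm' i.M i.hM hS i.j hjlo hjhi
        i.Ac i.e he' hl₄ h17 s⁻¹ t⁻¹ hp1' hpq hσ f μ) c₄le (lpW_nonneg _ _ _ _ f)

/-! ## §5. The typed statement, and non-vacuity -/

/-- **b04's TYPED LEMMA 2.2 — `B4.Lemma22Printed fam (d + 1)`, BOTH CONJUNCTS VERBATIM — INHABITED ON THE REGULAR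
CUBE-FIELD FAMILY** (the dimension parameter `d + 1` = the lattice dimension of the family, the print's `d`): conjunct 1
((2.16) for every `α < 1`) is `lemma22_16_cubeFieldFam`, conjunct 2 ((2.17), `p₁ > d + 1`, every pair of the
parallelogram, all three members) is `lemma22_17_cubeFieldFam`.  Row B4.Lem2.2 at `A ≠ 0` (model instance: the cube
configurations `Ã_j` of p. 575 of (1.7)-regular fields on boxes; companion of the zero-field leaf
`B4Lemma22ZeroBoxLpLq.lemma22Printed_cubeFam`). [cite: Balaban1983RegularityDecay, Lemma 2.2 (2.16)–(2.17) pp. 577–578] -/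
theorem lemma22Printed_cubeFieldFam :
    Lemma22Printed (cubeFieldFam F d ℓ amin aplus m2plus creg β S K) (d + 1) := by
  constructor
  · intro α hα
    exact lemma22_16_cubeFieldFam F hℓ₁ hLip d ℓ hℓ amin aplus m2plus ha creg β hcreg hβ S K hK α hα
  · intro p₁ hp₁
    have hp₁' : (d : ℝ) + 1 < p₁ := by exact_mod_cast hp₁
    exact lemma22_17_cubeFieldFam F hℓ₁ hLip d ℓ hℓ amin aplus m2plus ha creg β hcreg hβ S K hK hp₁'

omit hℓ₁ hLip ha hβ hK in
/-- NON-VACUITY: for every threshold `e₁ > 0` (and a non-empty `a`-window, `m²₊ ≥ 0`, `2K ≤ S`) some member of the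
family meets ALL typed antecedents with `0 < e ≤ e₁` — e.g. the cube `□_j` itself (`M_μ = 2K`, `j_μ = 1`) at scale
`k = 4` with the constant field `A = 0` —, so the uniformity in the member certified by `lemma22Printed_cubeFieldFam` is
exercised. [cite: Balaban1983RegularityDecay, Lemma 2.2 pp. 577–578 «for e sufficiently small», dictionary] -/
theorem antecedents_met (hap : amin ≤ aplus) (hm2 : 0 ≤ m2plus) (hK1 : 1 ≤ K) (hSK : 2 * K ≤ S) {e₁ : ℝ}
    (he₁ : 0 < e₁) :
    ∃ i : RegInst d ℓ amin aplus m2plus K,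
      (cubeFieldFam F d ℓ amin aplus m2plus creg β S K i).rect ∧
      (cubeFieldFam F d ℓ amin aplus m2plus creg β S K i).fewLargeBlocks ∧
      (cubeFieldFam F d ℓ amin aplus m2plus creg β S K i).regular ∧
      (cubeFieldFam F d ℓ amin aplus m2plus creg β S K i).constNearBdry ∧
      0 < (cubeFieldFam F d ℓ amin aplus m2plus creg β S K i).e ∧
      (cubeFieldFam F d ℓ amin aplus m2plus creg β S K i).e ≤ e₁ := by
  have h16 : 16 ≤ (ℓ + 1) ^ 4 * K := by
    have h1 : 2 ^ 4 ≤ (ℓ + 1) ^ 4 := Nat.pow_le_pow_left (by omega) 4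
    calc 16 = 2 ^ 4 * 1 := by norm_num
      _ ≤ (ℓ + 1) ^ 4 * K := Nat.mul_le_mul h1 hK1
  refine ⟨⟨4, by norm_num, h16, amin, le_rfl, hap, 0, le_rfl, hm2, fun _ => 2 * K, fun _ => by show 1 ≤ 2 * K; omega,
    fun _ => 1, fun _ _ => 0, e₁⟩, trivial, fun _ => hSK, ?_, ⟨fun _ => le_rfl, fun _ => by show (K : ℤ) * (1 + 1) ≤ ((2 * K : ℕ) : ℤ); push_cast; omega⟩,
    he₁, le_rfl⟩
  intro x _ μ ν
  simp only [sub_self, abs_zero]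
  positivity

end Main

end

end Literature.MathematicalPhysics.QuantumFieldTheory.Balaban1983to89.B4Lemma22RegularCubeFam
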